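import Summits.BirchSwinnertonDyer.BirchSwinnertonDyer.Theorems.GenusKolyvaginAtTwoGenusPrimitiveSupplyAtTwoPrimeTwistEggBit
import Summits.BirchSwinnertonDyer.BirchSwinnertonDyer.Theorems.GenusKolyvaginAtTwoCasselsTateNumberField
import HarnessLib

/-!
# Route `GenusKolyvaginAtTwo`, crux #2 `GenusPrimitiveSupplyAtTwo` (stmt-BirchSwinnertonDyer-22136):
# B⁰'s rank hypothesis discharged by finiteness of `Ш(W^{(d)})[2^∞]` — «`θ = −` ⟹ rank `1`» on the odd-branch frame

Width seat `bsd-line-gk2-p5` g16 (cell `bsd-f1-sign2`, SUPPLY lineage of crux 22136), file 44 of the series; sequel of file 43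
`…PrimeTwistEggBit` (B⁰ BY NAME for any model `V = C • W^{(d)}` under «`θ(V) = −` ⟹ rank `V(ℚ) ≥ 1`») and of the LEAD's
`…CasselsTateNumberField` (`#Ш[2^k]` is a square when `Ш[2^∞]` is finite). THEOREMS ONLY (no definition, no named fact, no `sorry`);
helper `--supports stmt-BirchSwinnertonDyer-22136`; no item is closed; BSD is not proved by any of this.

WHAT.
* §192 `natCard_sha_inf_torsionBy_eq` (bookkeeping: `#(Ш ⊓ H¹[n]) = #(Ш[n])` as a subgroup of the type `Ш`);
  **`mordellWeilRank_eq_one_of_finite_sha_of_not_shaTwoInTwiceShaFour_of_model`**: `W` on the odd branch, `d` descent-admissible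
  with character `χ`, `V = C • W^{(d)}` ANY model with `Ш(V)[2^∞]` FINITE and `θ(V) = −` ⟹ `rank V(ℚ) = 1`.  Proof: the descent count
  `8 = 2^{rank}·#V(ℚ)[2]·#Ш(V)[2]` (dictionary + `card_selmerGroup_eq_pow_rank_mul`), `#V(ℚ)[2] = 1` (no rational `2`-torsion on any
  model of the twist), `#Ш(V)[2]` a SQUARE (`CasselsTateNumberField.isSquare_natCard_sha_torsionBy_pow`, finite `Ш[2^∞]`) and `≥ 2`
  (`θ = −` exhibits a non-zero class) ⟹ `#Ш(V)[2] = 4`, `2^{rank} = 2`.  This is the classical reading of the `-desc` row's rank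
  clause («automatic under finiteness of `Ш(W^{(dᵢ)})[2^∞]`»).
* §193 **`eggBit_iff_twistRadicalLeaves_of_model_of_finite`** — B⁰'s dictionary with the rank clause replaced by `Finite Ш(V)[2^∞]`;
  **`oddBranchEggBitEqRadicalBit_of_finite_sha`** — the row's conclusion for `W^{(d)}` itself under `Finite Ш(W^{(d)})[2^∞]`.
* §194 `not_shaTwoInTwiceShaFour_and_meetsEgg_iff_of_models` — the egg–Cassels–Tate bit is MODEL-INDEPENDENT on the frame (two models of
  `W^{(d)}`, each of positive rank when odd, have the same bit: both equal the radical bit of `A_χ`).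

Honest framing: Cassels 1962 (`Ш[2^∞] ≅ L × L` when finite) + file 43; kernel-new bookkeeping; beyond-print theorem: no. Crux 22136 stays
OPEN exactly at (U) 24947 ∧ (CONV₂) 19220/24948. BSD is not proved by any of this.

References: [Cassels1962ArithmeticIV] §1; [Kramer1981] Prop. 6; [SilvermanAEC2009] Thm. X.4.2(a), Thm. X.4.14.
-/

set_option linter.dupNamespace false -- tree convention: `Summit.BirchSwinnertonDyer.BirchSwinnertonDyer.Theorems` (summit = sub-problem)
set_option autoImplicit false

noncomputable section

open scoped Classical

namespace Summit.BirchSwinnertonDyer.BirchSwinnertonDyer.Theorems.GenusKolyArch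

open WeierstrassCurve Field NumberField IsDedekindDomain
open Literature.NumberTheory.EllipticCurves Literature.NumberTheory.GaloisRepresentations
open Summit.BirchSwinnertonDyer.Rank1Residual.F1Sign2
open Summit.BirchSwinnertonDyer.Rank1Residual.F1Sign2.EggDoubling (eq_zero_of_two_smul_eq_zero)
open Literature.NumberTheory.EllipticCurves.Greenberg1999 (HasRationalTwoTorsionX)
open Summit.BirchSwinnertonDyer.BirchSwinnertonDyer.Theorems.GenusExact (CasselsTateNumberField.isSquare_natCard_sha_torsionBy_pow)

universe u

/-! ## §192 Finite `Ш[2^∞]` and `θ = −` force rank `1` on the frame -/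

/-- Bookkeeping: `#(Ш(V/K) ⊓ H¹(K,E)[n]) = #(Ш(V/K)[n])`, the `n`-torsion counted inside the type `Ш`. [folklore] -/
theorem natCard_sha_inf_torsionBy_eq {K : Type u} [Field K] [NumberField K] (V : WeierstrassCurve K) (n : ℕ) :
    Nat.card ↥(V.sha ⊓ AddSubgroup.torsionBy V.galH1 (n : ℤ)) = Nat.card (AddSubgroup.torsionBy (↥V.sha) (n : ℤ)) :=
  Nat.card_congr
    { toFun := fun x ↦ ⟨⟨x.1, (AddSubgroup.mem_inf.mp x.2).1⟩, AddSubgroup.torsionBy.nsmul_iff.mpr (Subtype.ext (by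
          rw [AddSubgroupClass.coe_nsmul, ZeroMemClass.coe_zero]
          exact AddSubgroup.torsionBy.nsmul_iff.mp (AddSubgroup.mem_inf.mp x.2).2))⟩
      invFun := fun y ↦ ⟨(y.1 : V.galH1), AddSubgroup.mem_inf.mpr ⟨y.1.2, AddSubgroup.torsionBy.nsmul_iff.mpr (by
          have h := AddSubgroup.torsionBy.nsmul_iff.mp y.2
          rw [← AddSubgroupClass.coe_nsmul, h, ZeroMemClass.coe_zero])⟩⟩
      left_inv := fun x ↦ by ext; rfl
      right_inv := fun y ↦ by ext; rfl }

section Frame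

variable (W : WeierstrassCurve ℚ) [W.IsElliptic] [W.IsGloballyMinimal] {d : ℤ}
  {χ : absoluteGaloisGroup ℚ →ₜ* Multiplicative (ZMod 2)}

omit [W.IsElliptic] in
/-- **§192 — finite `Ш(V)[2^∞]` and `θ(V) = −` ⟹ `rank V(ℚ) = 1`** for ANY model `V = C • W^{(d)}` of a descent-admissible twist of a
curve `W` on the odd branch. See the module docstring. [cite: Cassels1962ArithmeticIV, §1] [cite: SilvermanAEC2009, Thm X.4.2(a) and Thm. X.4.14]
[cite: Kramer1981, Prop. 6] -/
theorem mordellWeilRank_eq_one_of_finite_sha_of_not_shaTwoInTwiceShaFour_of_model (hodd : OnOddBranchAtTwo W)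
    (hd : DescAdmissible W d) (hχ : IsQuadraticCharacterOf χ d) {V : WeierstrassCurve ℚ} [V.IsElliptic] {C : VariableChange ℚ}
    (hWd : C • W.quadraticTwist (d : ℚ) = V) [Finite (AddCommGroup.primaryComponent V.sha 2)]
    (hθ : ¬ ShaTwoInTwiceShaFour V) : V.mordellWeilRank = 1 := by
  have hd0 : d ≠ 0 := hd.1.ne
  have hd0' : ((d : ℤ) : ℚ) ≠ 0 := Int.cast_ne_zero.mpr hd0
  -- no rational `2`-torsion on the model `V`
  have hTV : NoRationalTwoTorsion V := by
    intro x hx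
    have h' : HasRationalTwoTorsionX (W.quadraticTwist (d : ℚ)) (C⁻¹.toX x) := by
      have h := PrimeConductorTwoTorsion.hasRationalTwoTorsionX_smul V C⁻¹ hx
      rwa [← hWd, inv_smul_smul] at h
    obtain ⟨x', hx'⟩ := (exists_hasRationalTwoTorsionX_quadraticTwist_iff W hd0').mp ⟨_, h'⟩
    exact hodd.2.1 x' hx'
  -- the descent count `8 = 2^rank · #V(ℚ)[2] · #Ш(V)[2]`
  have hSel8 : Nat.card (V.selmerGroup ((2 : ℕ) : ℤ)) = 8 := by
    rw [← natCard_primeTwist_selmerGroup_eq_natCard_selmerGroup_rat W hd0 hχ hWd,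
      natCard_primeTwist_selmerGroup_eq_twistSelmerTwoCard W hd0 hχ]
    exact hodd.2.2.2.2 d hd
  have hcount := card_selmerGroup_eq_pow_rank_mul V 2
  rw [hSel8] at hcount
  -- `#V(ℚ)[2] = 1` (transport along the `DecidableEq ℚ` instance of the descent count, as in file 30)
  have hinst : (instDecidableEqRat : DecidableEq ℚ) = fun a b => Classical.propDecidable (a = b) := Subsingleton.elim _ _
  have ha : Nat.card (AddSubgroup.torsionBy V.toAffine.Point ((2 : ℕ) : ℤ)) = 1 := by
    have hbot : AddSubgroup.torsionBy V.toAffine.Point ((2 : ℕ) : ℤ) = ⊥ :=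
      (AddSubgroup.eq_bot_iff_forall _).mpr fun P hP ↦
        eq_zero_of_two_smul_eq_zero V hTV P (AddSubgroup.torsionBy.nsmul_iff.mp hP)
    rw [hbot, AddSubgroup.card_bot]
  rw [hinst] at ha
  rw [ha, mul_one] at hcount
  -- `#Ш(V)[2]` is a square (finite `Ш[2^∞]`, Cassels–Tate) and `≥ 2` (`θ = −`)
  have hsq : IsSquare (Nat.card ↥(V.sha ⊓ AddSubgroup.torsionBy V.galH1 ((2 : ℕ) : ℤ))) := by
    have h := CasselsTateNumberField.isSquare_natCard_sha_torsionBy_pow V 2 1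
    rw [pow_one] at h
    rwa [natCard_sha_inf_torsionBy_eq]
  have hb0 : Nat.card ↥(V.sha ⊓ AddSubgroup.torsionBy V.galH1 ((2 : ℕ) : ℤ)) ≠ 0 := fun h0 ↦ by
    rw [h0, mul_zero] at hcount; exact absurd hcount (by norm_num)
  haveI : Finite ↥(V.sha ⊓ AddSubgroup.torsionBy V.galH1 ((2 : ℕ) : ℤ)) := Nat.finite_of_card_ne_zero hb0
  have hb2 : 2 ≤ Nat.card ↥(V.sha ⊓ AddSubgroup.torsionBy V.galH1 ((2 : ℕ) : ℤ)) := by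
    have hθ' := hθ
    unfold ShaTwoInTwiceShaFour at hθ'
    push Not at hθ'
    obtain ⟨s, hs, hs2, hsnot⟩ := hθ'
    have hs0 : s ≠ 0 := fun h ↦ hsnot 0 V.sha.zero_mem (nsmul_zero _) (by rw [nsmul_zero, h])
    set H : AddSubgroup V.galH1 := V.sha ⊓ AddSubgroup.torsionBy V.galH1 ((2 : ℕ) : ℤ) with hH
    have hsub : ({0, s} : Set V.galH1) ⊆ (H : Set V.galH1) := by
      intro y hy
      simp only [Set.mem_insert_iff, Set.mem_singleton_iff] at hy
      rcases hy with rfl | rfl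
      · exact H.zero_mem
      · exact AddSubgroup.mem_inf.mpr ⟨hs, AddSubgroup.torsionBy.nsmul_iff.mpr hs2⟩
    have hle := Set.ncard_le_ncard hsub (Set.toFinite _)
    rw [Set.ncard_pair hs0.symm, (Nat.card_coe_set_eq (H : Set V.galH1)).symm] at hle
    exact hle
  -- arithmetic: `8 = 2^r · b`, `b` a square `≥ 2` ⟹ `b = 4`, `r = 1`
  have key : ∀ r b : ℕ, 8 = 2 ^ r * b → IsSquare b → 2 ≤ b → r = 1 := by
    intro r b h hbsq hb
    obtain ⟨m, rfl⟩ := hbsq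
    have hmm : m * m ≤ 8 := by
      calc m * m = 1 * (m * m) := (one_mul _).symm
        _ ≤ 2 ^ r * (m * m) := Nat.mul_le_mul_right _ Nat.one_le_two_pow
        _ = 8 := h.symm
    have hm : m ≤ 2 := by
      by_contra hgt
      push Not at hgt
      have h9 : 3 * 3 ≤ m * m := Nat.mul_le_mul hgt hgt
      omega
    interval_cases m
    · omega
    · omega
    · have h2 : 2 ^ r = 2 := by omega
      have hr1 : r < 2 := by
        by_contra hge
        push Not at hge
        have h4 : 4 ≤ 2 ^ r := by
          calc (4 : ℕ) = 2 ^ 2 := rfl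
            _ ≤ 2 ^ r := Nat.pow_le_pow_right two_pos hge
        omega
      have hr0 : r ≠ 0 := by rintro rfl; simp at h2
      omega
  exact key _ _ hcount hsq hb2

/-! ## §193 B⁰ with the rank clause replaced by finiteness of `Ш(V)[2^∞]` -/

/-- **B⁰'s dictionary under `Finite Ш(V)[2^∞]`**: for `W` on the odd branch, `d` descent-admissible with character `χ`, and any model
`V = C • W^{(d)}` whose `Ш[2^∞]` is finite, `(θ(V) = − ∧ MeetsEgg V) ↔ TwistRadicalLeavesAtTwo W χ Sel₂(W)` — file 43's
`eggBit_iff_twistRadicalLeaves_of_model` with its rank clause supplied by §192. [cite: Cassels1962ArithmeticIV, §1] [cite: Kramer1981, Prop. 6] -/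
theorem eggBit_iff_twistRadicalLeaves_of_model_of_finite (hodd : OnOddBranchAtTwo W) (hd : DescAdmissible W d)
    (hχ : IsQuadraticCharacterOf χ d) {V : WeierstrassCurve ℚ} [V.IsElliptic] {C : VariableChange ℚ}
    (hWd : C • W.quadraticTwist (d : ℚ) = V) [Finite (AddCommGroup.primaryComponent V.sha 2)] :
    (¬ ShaTwoInTwiceShaFour V ∧ MeetsEgg V) ↔ TwistRadicalLeavesAtTwo W χ (W.selmerGroup ((2 : ℕ) : ℤ)) :=
  eggBit_iff_twistRadicalLeaves_of_model W hodd hd hχ hWd fun hθ ↦ by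
    rw [mordellWeilRank_eq_one_of_finite_sha_of_not_shaTwoInTwiceShaFour_of_model W hodd hd hχ hWd hθ]
    exact one_pos

/-- **The row's conclusion for `W^{(d)}` itself under `Finite Ш(W^{(d)})[2^∞]`**: `EggCasselsTateBitAtTwo W d ↔
TwistRadicalLeavesAtTwo W χ Sel₂(W)` on the odd branch for every descent-admissible `d` with character `χ`.
[cite: Cassels1962ArithmeticIV, §1] [cite: Kramer1981, Prop. 6] -/
theorem oddBranchEggBitEqRadicalBit_of_finite_sha (hodd : OnOddBranchAtTwo W) (hd : DescAdmissible W d)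
    (hχ : IsQuadraticCharacterOf χ d) [Finite (AddCommGroup.primaryComponent (W.quadraticTwist (d : ℚ)).sha 2)] :
    EggCasselsTateBitAtTwo W d ↔ TwistRadicalLeavesAtTwo W χ (W.selmerGroup ((2 : ℕ) : ℤ)) := by
  haveI : (W.quadraticTwist (d : ℚ)).IsElliptic := W.isElliptic_quadraticTwist (Int.cast_ne_zero.mpr hd.1.ne)
  exact eggBit_iff_twistRadicalLeaves_of_model_of_finite W hodd hd hχ (one_smul _ _)

/-! ## §194 Model-independence of the egg–Cassels–Tate bit on the frame -/

/-- **The egg–Cassels–Tate bit does not depend on the model** (on the frame): for `W` on the odd branch, `d` descent-admissible and two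
models `V = C • W^{(d)}`, `V' = C' • W^{(d)}` each of positive rank when its form is odd, `(θ(V) = − ∧ MeetsEgg V) ↔ (θ(V') = − ∧ MeetsEgg V')`
— both sides equal the radical bit of `A_χ` (file 43 §188; `χ` exists by `GenusKolyTransp.quadraticCharacterExists_holds`). This is the
«model-independent» remark of the typed helper `F1Sign2.EggCasselsTateBitAtTwo`, on the frame. [cite: Kramer1981, Prop. 6] [cite: MazurRubin2007, §3] -/
theorem not_shaTwoInTwiceShaFour_and_meetsEgg_iff_of_models (hodd : OnOddBranchAtTwo W) (hd : DescAdmissible W d)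
    {V : WeierstrassCurve ℚ} [V.IsElliptic] {C : VariableChange ℚ} (hWd : C • W.quadraticTwist (d : ℚ) = V)
    (hrk : ¬ ShaTwoInTwiceShaFour V → 0 < V.mordellWeilRank)
    {V' : WeierstrassCurve ℚ} [V'.IsElliptic] {C' : VariableChange ℚ} (hWd' : C' • W.quadraticTwist (d : ℚ) = V')
    (hrk' : ¬ ShaTwoInTwiceShaFour V' → 0 < V'.mordellWeilRank) :
    (¬ ShaTwoInTwiceShaFour V ∧ MeetsEgg V) ↔ (¬ ShaTwoInTwiceShaFour V' ∧ MeetsEgg V') := by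
  obtain ⟨χ, hχ⟩ := GenusKolyTransp.quadraticCharacterExists_holds d
  exact (eggBit_iff_twistRadicalLeaves_of_model W hodd hd hχ hWd hrk).trans
    (eggBit_iff_twistRadicalLeaves_of_model W hodd hd hχ hWd' hrk').symm

end Frame

end Summit.BirchSwinnertonDyer.BirchSwinnertonDyer.Theorems.GenusKolyArch

end
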